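import Mathlib
import Summits.Ventures.DiscreteObjects.Mahler.FourTermAbsTwoFactors
import Summits.Ventures.DiscreteObjects.Mahler.UnitMeasureFactors
import Summits.Ventures.DiscreteObjects.Mahler.MahlerMeasureCompXPow
import Summits.Ventures.DiscreteObjects.Mahler.SubLehmerDegreeTwentyFour

/-!
# Sparse reciprocal polynomials V: no quadrinomial `x^{p+q} ± 2x^p ± 2x^q ± 1` is sub-Lehmer
(venture `DiscreteObjects`, target L)

Cell `pub-namedobj`, seat `pub-namedobj-mahler-g24`. Framing: lottery ticket; floor = certified
bounds/negative ranges.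

`P = x^{p+q} + b x^p + s b x^q + s`, `|b| = 2`, `0 < p < q`, `s = ±1`, `k = q - p`, `n = p + q`,
`g = gcd(n, p)`:

* `eq_natAbs_mul_of_cyclotomic_sq_dvd_of_dvd` — a repeated type A cyclotomic factor forces `n = |b| k`
  (any `b`; for `|b| = 2` this means `n = 4p`, `g = p`);
* `exists_cyclotomicFree_factor_quadrinomial_two` — for `n ≠ 2k`: `P = C_A C_B Q` with `Q`
  cyclotomic-free, `C_A ∣ x^k + s`, `C_A ∣ x^{2p} - 1`, `C_B ∣ xⁿ - s`, `C_B ∣ x^{3p} - sε`;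
  hence `deg C_A ≤ gcd(k, 2p) ≤ 2g`, `deg C_B ≤ gcd(n, 3p) ≤ 3g`;
* `not_subLehmer_quadrinomial_two` — **no such `P` is sub-Lehmer**: if `10 g ≤ n` then `deg Q ≥ n/2`
  and the even resultant step (`x^{2n} - 1 ≡ 0 (mod 4, Q)`) gives `M(P)⁴ ≥ 2`; if `10 g > n` then
  `P = R(x^g)` with `deg R = n/g ≤ 9` and the kernel ladder (`twentyfour_le_natDegree_of_subLehmer`,
  the cell's degree-`≤ 23` census) applies to `R`, `M(P) = M(R)`.

In print: [Dobrowolski2006] E. Dobrowolski, Acta Arith. 123 (2006), Prop. 2, gives the sharp `M(f) ≥ θ₀` for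
every monic quadrinomial with `f(0) ≠ 0` that is not a product of cyclotomics (finitely many cases there
"checked by direct computation of `M(f)`"); here the residual finite set is discharged by the cell's kernel
census instead, whence the weaker but kernel-certified conclusion "not sub-Lehmer" (REPLICATION).
-/

namespace Summit.Ventures.DiscreteObjects.Mahler

open Polynomial

section Quadrinomial

variable {p q : ℕ} {b s : ℤ}

/-- **A repeated type A cyclotomic factor forces `p + q = |b| (q - p)`** (any `b`): if `Φ_r ∣ x^{q-p} + s`
and `Φ_r² ∣ P`, then at a primitive `r`-th root of unity `ζ`: `ζ^{q-p} = -s`, `ζⁿ = -s`, and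
`ζ P'(ζ) = 0` reads `b (q - p) ζ^p = -s n`. -/
theorem eq_natAbs_mul_of_cyclotomic_sq_dvd_of_dvd (hp : 0 < p) (hpq : p < q) (hs : s = 1 ∨ s = -1)
    {r : ℕ} (hr : 0 < r) (hW : cyclotomic r ℤ ∣ (X ^ (q - p) + C s : ℤ[X]))
    (hdvd : cyclotomic r ℤ * cyclotomic r ℤ ∣ (X ^ (p + q) + C b * X ^ p + C (s * b) * X ^ q + C s : ℤ[X])) :
    p + q = b.natAbs * (q - p) := by
  set Φ : ℤ[X] := cyclotomic r ℤ with hΦ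
  set P : ℤ[X] := X ^ (p + q) + C b * X ^ p + C (s * b) * X ^ q + C s with hP
  have hss : s * s = 1 := by rcases hs with h | h <;> simp [h]
  have hs2 : (s : ℂ) * s = 1 := by exact_mod_cast hss
  have hdvd1 : Φ ∣ P := dvd_trans (dvd_mul_right Φ Φ) hdvd
  have hV := (dvd_X_pow_add_and_sub_of_dvd hpq hs hdvd1 hW).1
  set ζ : ℂ := Complex.exp (2 * Real.pi * Complex.I / r) with hζdef
  have hprim : IsPrimitiveRoot ζ r := Complex.isPrimitiveRoot_exp r (by omega)
  have hζ1 : ‖ζ‖ = 1 := hprim.norm'_eq_one hr.ne'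
  have hΦζ : aeval ζ Φ = 0 := by
    have h := hprim.isRoot_cyclotomic hr (R := ℂ)
    rw [IsRoot.def, ← map_cyclotomic_int, eval_map] at h
    rwa [aeval_def, algebraMap_int_eq]
  have aeval_of_dvd : ∀ {F : ℤ[X]}, Φ ∣ F → aeval ζ F = 0 := by
    intro F hF; obtain ⟨R, hR⟩ := hF; rw [hR, map_mul, hΦζ, zero_mul]
  have hk : ζ ^ (q - p) = -(s : ℂ) := by
    have h := aeval_of_dvd hW
    simp only [map_add, map_pow, aeval_X, eq_intCast, map_intCast] at h
    exact eq_neg_of_add_eq_zero_left h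
  have hnn : ζ ^ (p + q) = -(s : ℂ) := by
    have h := aeval_of_dvd hV
    simp only [map_add, map_pow, aeval_X, eq_intCast, map_intCast] at h
    exact eq_neg_of_add_eq_zero_left h
  have hq : ζ ^ q = -(s : ℂ) * ζ ^ p := by
    rw [show q = p + (q - p) by omega, pow_add, hk]; ring
  have hder : Φ ∣ derivative P := by
    obtain ⟨R, hR⟩ := hdvd
    rw [hR, mul_assoc, derivative_mul]
    exact dvd_add ((dvd_mul_right Φ R).mul_left _) (dvd_mul_right _ _)
  have hder' : derivative P = C ((p + q : ℕ) : ℤ) * X ^ (p + q - 1) + C (b * (p : ℤ)) * X ^ (p - 1) +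
      C (s * b * (q : ℤ)) * X ^ (q - 1) := by
    rw [hP]
    simp only [derivative_add, derivative_X_pow, derivative_C_mul_X_pow, derivative_C, add_zero]
  have hE := aeval_of_dvd hder
  rw [hder'] at hE
  simp only [map_add, map_mul, map_pow, aeval_X, eq_intCast, map_intCast, map_natCast] at hE
  have hE' : ((p + q : ℕ) : ℂ) * ζ ^ (p + q) + b * p * ζ ^ p + s * b * q * ζ ^ q = 0 := by
    have e1 : ζ ^ (p + q) = ζ * ζ ^ (p + q - 1) := (mul_pow_sub_one (by omega) ζ).symm
    have e2 : ζ ^ p = ζ * ζ ^ (p - 1) := (mul_pow_sub_one (by omega) ζ).symm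
    have e3 : ζ ^ q = ζ * ζ ^ (q - 1) := (mul_pow_sub_one (by omega) ζ).symm
    rw [e1, e2, e3]
    linear_combination ζ * hE
  rw [hnn, hq] at hE'
  have hkey : (b : ℂ) * ((q : ℂ) - p) * ζ ^ p = -((s : ℂ) * ((p + q : ℕ) : ℂ)) := by
    linear_combination (-1 : ℂ) * hE' + (-(b : ℂ) * q * ζ ^ p) * hs2
  have hnorm := congrArg (fun z : ℂ => ‖z‖) hkey
  simp only [norm_mul, norm_neg, norm_pow, hζ1, one_pow, mul_one, Complex.norm_intCast,
    Complex.norm_natCast] at hnorm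
  have hqp : ‖((q : ℂ) - p)‖ = ((q - p : ℕ) : ℝ) := by
    rw [show ((q : ℂ) - p) = ((q - p : ℕ) : ℂ) by rw [Nat.cast_sub hpq.le], Complex.norm_natCast]
  have hs1 : |(s : ℝ)| = 1 := by rcases hs with h | h <;> simp [h]
  have hb' : (b.natAbs : ℝ) = |(b : ℝ)| := by rw [Nat.cast_natAbs, Int.cast_abs]
  rw [hqp, hs1, one_mul, ← hb'] at hnorm
  exact_mod_cast hnorm.symm

/-- **Cyclotomic part vs. cyclotomic-free part, `|b| = 2`** (outside `n = 2k`, i.e. `n ≠ 4p`):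
`P = C_A · C_B · Q` with `Q` cyclotomic-free, `C_A ∣ x^{q-p} + s`, `C_A ∣ x^{2p} - 1` (type A factors,
each simple), `C_B ∣ xⁿ - s`, `C_B ∣ x^{3p} - sε` (type B factors, each simple). -/
theorem exists_cyclotomicFree_factor_quadrinomial_two (hp : 0 < p) (hpq : p < q) (hs : s = 1 ∨ s = -1)
    {ε : ℤ} (hε : ε = 1 ∨ ε = -1) (hb : b = 2 * ε) (hgen : p + q ≠ 2 * (q - p)) :
    ∃ CA CB Q : ℤ[X], (X ^ (p + q) + C b * X ^ p + C (s * b) * X ^ q + C s : ℤ[X]) = CA * CB * Q ∧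
      CA ∣ (X ^ (q - p) + C s : ℤ[X]) ∧ CA ∣ (X ^ (2 * p) - 1 : ℤ[X]) ∧
      CB ∣ (X ^ (p + q) - C s : ℤ[X]) ∧ CB ∣ (X ^ (3 * p) - C (s * ε) : ℤ[X]) ∧
      (∀ k : ℕ, 0 < k → ¬ cyclotomic k ℤ ∣ Q) := by
  set P : ℤ[X] := X ^ (p + q) + C b * X ^ p + C (s * b) * X ^ q + C s with hP
  have hP0 : P ≠ 0 := (quadrinomial_monic_natDegree hp hpq b s).1.ne_zero
  have hb2 : b = 2 ∨ b = -2 := by rcases hε with h | h <;> simp [hb, h]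
  have hbabs : b.natAbs = 2 := by rcases hb2 with h | h <;> simp [h]
  have key : ∀ d : ℕ, ∀ CA CB Q : ℤ[X], Q.natDegree = d → P = CA * CB * Q →
      CA ∣ (X ^ (q - p) + C s : ℤ[X]) → CA ∣ (X ^ (2 * p) - 1 : ℤ[X]) →
      CB ∣ (X ^ (p + q) - C s : ℤ[X]) → CB ∣ (X ^ (3 * p) - C (s * ε) : ℤ[X]) →
      ∃ CA' CB' Q' : ℤ[X], P = CA' * CB' * Q' ∧
        CA' ∣ (X ^ (q - p) + C s : ℤ[X]) ∧ CA' ∣ (X ^ (2 * p) - 1 : ℤ[X]) ∧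
        CB' ∣ (X ^ (p + q) - C s : ℤ[X]) ∧ CB' ∣ (X ^ (3 * p) - C (s * ε) : ℤ[X]) ∧
        (∀ k : ℕ, 0 < k → ¬ cyclotomic k ℤ ∣ Q') := by
    intro d
    induction d using Nat.strong_induction_on with
    | _ d ih =>
      intro CA CB Q hd hPQ hAW hAV hBn hB3
      by_cases hcf : ∀ k : ℕ, 0 < k → ¬ cyclotomic k ℤ ∣ Q
      · exact ⟨CA, CB, Q, hPQ, hAW, hAV, hBn, hB3, hcf⟩
      push Not at hcf
      obtain ⟨m, hm, hmQ⟩ := hcf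
      obtain ⟨R, hR⟩ := hmQ
      have hQ0 : Q ≠ 0 := by rintro rfl; rw [mul_zero] at hPQ; exact hP0 hPQ
      have hR0 : R ≠ 0 := by rintro rfl; rw [mul_zero] at hR; exact hQ0 hR
      have hΦ0 : cyclotomic m ℤ ≠ 0 := cyclotomic_ne_zero m ℤ
      have hmP : cyclotomic m ℤ ∣ P := ⟨CA * CB * R, by rw [hPQ, hR]; ring⟩
      have hprime : Prime (cyclotomic m ℤ) := (cyclotomic.irreducible hm).prime
      have hdR : R.natDegree < d := by
        rw [← hd, hR, natDegree_mul hΦ0 hR0, natDegree_cyclotomic]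
        have := Nat.totient_pos.mpr hm
        omega
      rcases cyclotomic_dvd_or_of_dvd_quadrinomial_two hp hpq hs hb2 hm hmP with hA | hB
      · -- type A: goes into `CA`
        have hmV := (dvd_X_pow_add_and_sub_of_dvd hpq hs hmP hA).2
        have hnA : ¬ cyclotomic m ℤ ∣ CA := by
          rintro ⟨CA', hCA'⟩
          have h2 : cyclotomic m ℤ * cyclotomic m ℤ ∣ P := ⟨CA' * CB * R, by rw [hPQ, hR, hCA']; ring⟩
          have := eq_natAbs_mul_of_cyclotomic_sq_dvd_of_dvd hp hpq hs hm hA h2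
          rw [hbabs] at this
          exact hgen this
        have hW' : CA * cyclotomic m ℤ ∣ (X ^ (q - p) + C s : ℤ[X]) := by
          obtain ⟨W', hW'⟩ := hAW
          have : cyclotomic m ℤ ∣ W' := by
            rcases hprime.dvd_or_dvd (hW' ▸ hA) with h | h
            · exact absurd h hnA
            · exact h
          rw [hW']; exact mul_dvd_mul_left CA this
        have hV' : CA * cyclotomic m ℤ ∣ (X ^ (2 * p) - 1 : ℤ[X]) := by
          obtain ⟨V', hV'⟩ := hAV
          have : cyclotomic m ℤ ∣ V' := by
            rcases hprime.dvd_or_dvd (hV' ▸ hmV) with h | h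
            · exact absurd h hnA
            · exact h
          rw [hV']; exact mul_dvd_mul_left CA this
        exact ih R.natDegree hdR (CA * cyclotomic m ℤ) CB R rfl (by rw [hPQ, hR]; ring) hW' hV' hBn hB3
      · -- type B: goes into `CB`
        obtain ⟨hY, h3⟩ := cyclotomic_dvd_of_typeB hs hε hb hm hmP hB
        have hnB : ¬ cyclotomic m ℤ ∣ CB := by
          rintro ⟨CB', hCB'⟩
          have h2 : cyclotomic m ℤ * cyclotomic m ℤ ∣ P := ⟨CA * CB' * R, by rw [hPQ, hR, hCB']; ring⟩
          exact not_cyclotomic_sq_dvd_of_typeB hp hpq hs hε hb hm hB hY h2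
        have hn' : CB * cyclotomic m ℤ ∣ (X ^ (p + q) - C s : ℤ[X]) := by
          obtain ⟨W', hW'⟩ := hBn
          have : cyclotomic m ℤ ∣ W' := by
            rcases hprime.dvd_or_dvd (hW' ▸ hB) with h | h
            · exact absurd h hnB
            · exact h
          rw [hW']; exact mul_dvd_mul_left CB this
        have h3' : CB * cyclotomic m ℤ ∣ (X ^ (3 * p) - C (s * ε) : ℤ[X]) := by
          obtain ⟨V', hV'⟩ := hB3
          have : cyclotomic m ℤ ∣ V' := by
            rcases hprime.dvd_or_dvd (hV' ▸ h3) with h | h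
            · exact absurd h hnB
            · exact h
          rw [hV']; exact mul_dvd_mul_left CB this
        exact ih R.natDegree hdR CA (CB * cyclotomic m ℤ) R rfl (by rw [hPQ, hR]; ring) hAW hAV hn' h3'
  exact key P.natDegree 1 1 P rfl (by ring) (one_dvd _) (one_dvd _) (one_dvd _) (one_dvd _)

/-- `gcd(q - p, 2p) ≤ 2 gcd(p + q, p)` and `gcd(p + q, 3p) ≤ 3 gcd(p + q, p)` (for `p < q`). -/
theorem gcd_bounds (hp : 0 < p) (hpq : p < q) :
    Nat.gcd (q - p) (2 * p) ≤ 2 * Nat.gcd (p + q) p ∧ Nat.gcd (p + q) (3 * p) ≤ 3 * Nat.gcd (p + q) p := by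
  have hg0 : 0 < Nat.gcd (p + q) p := Nat.gcd_pos_of_pos_right _ hp
  have hkp : Nat.gcd (q - p) p = Nat.gcd (p + q) p := by
    apply Nat.dvd_antisymm
    · refine Nat.dvd_gcd ?_ (Nat.gcd_dvd_right _ _)
      have h1 := Nat.gcd_dvd_left (q - p) p
      have h2 := Nat.gcd_dvd_right (q - p) p
      have : p + q = (q - p) + 2 * p := by omega
      rw [this]
      exact Nat.dvd_add h1 (dvd_mul_of_dvd_right h2 _)
    · refine Nat.dvd_gcd ?_ (Nat.gcd_dvd_right _ _)
      have h1 := Nat.gcd_dvd_left (p + q) p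
      have h2 := Nat.gcd_dvd_right (p + q) p
      have : q - p = (p + q) - 2 * p := by omega
      rw [this]
      exact Nat.dvd_sub h1 (dvd_mul_of_dvd_right h2 _)
  constructor
  · have h : Nat.gcd (q - p) (2 * p) ∣ 2 * Nat.gcd (q - p) p := by
      rw [← Nat.gcd_mul_left]
      exact Nat.dvd_gcd (dvd_mul_of_dvd_right (Nat.gcd_dvd_left _ _) _) (Nat.gcd_dvd_right _ _)
    rw [hkp] at h
    exact Nat.le_of_dvd (by omega) h
  · have h : Nat.gcd (p + q) (3 * p) ∣ 3 * Nat.gcd (p + q) p := by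
      rw [← Nat.gcd_mul_left]
      exact Nat.dvd_gcd (dvd_mul_of_dvd_right (Nat.gcd_dvd_left _ _) _) (Nat.gcd_dvd_right _ _)
    exact Nat.le_of_dvd (by omega) h

/-- The quadrinomial is `R(x^g)` for every common divisor `g` of `p` and `q`. -/
theorem quadrinomial_eq_comp_X_pow {g p' q' : ℕ} (b s : ℤ) :
    (X ^ (p' * g + q' * g) + C b * X ^ (p' * g) + C (s * b) * X ^ (q' * g) + C s : ℤ[X]) =
      (X ^ (p' + q') + C b * X ^ p' + C (s * b) * X ^ q' + C s : ℤ[X]).comp (X ^ g) := by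
  simp only [add_comp, mul_comp, pow_comp, X_comp, C_comp]
  ring

/-- **No quadrinomial `x^{p+q} + b x^p + s b x^q + s` with `|b| = 2` is sub-Lehmer** (`0 < p < q`,
`s = ±1`), with or without cyclotomic factors.  If `10 gcd(p+q, p) ≤ p + q`: `P = C_A C_B Q`,
`deg(C_A C_B) ≤ 5 gcd(p+q, p) ≤ n/2`, `M(C_A) = M(C_B) = 1`, and the even resultant step on `Q`
(`x^{2n} - 1 = 4ε·T(εT + s) + Q·(C_A C_B H)`) gives `4^{deg Q} ≤ 2^{deg Q} M^{2n}`, so `M⁴ ≥ 2`;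
else `P = R(x^g)` with `deg R ≤ 9 < 24` and `M(P) = M(R)` is not sub-Lehmer by the kernel census. -/
theorem not_subLehmer_quadrinomial_two (hp : 0 < p) (hpq : p < q) (hs : s = 1 ∨ s = -1)
    (hb : b = 2 ∨ b = -2) :
    ¬ SubLehmer (X ^ (p + q) + C b * X ^ p + C (s * b) * X ^ q + C s : ℤ[X]) := by
  obtain ⟨hmon, hdeg⟩ := quadrinomial_monic_natDegree hp hpq b s
  set g := Nat.gcd (p + q) p with hg
  have hg0 : 0 < g := Nat.gcd_pos_of_pos_right _ hp
  have hgp : g ∣ p := Nat.gcd_dvd_right _ _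
  have hgq : g ∣ q := by
    have h := Nat.gcd_dvd_left (p + q) p
    have : q = (p + q) - p := by omega
    rw [this]; exact Nat.dvd_sub h hgp
  by_cases hsmall : p + q < 10 * g
  · -- `P = R(x^g)`, `deg R = (p+q)/g ≤ 9`
    obtain ⟨p', hp'⟩ := hgp
    obtain ⟨q', hq'⟩ := hgq
    have hp'0 : 0 < p' := by
      rcases Nat.eq_zero_or_pos p' with h | h
      · rw [h, mul_zero] at hp'; omega
      · exact h
    have hp'q' : p' < q' := by
      by_contra h; push Not at h
      have : q ≤ p := by rw [hp', hq']; exact Nat.mul_le_mul_left g h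
      omega
    have hsum : p' + q' < 10 := by
      have : g * (p' + q') < g * 10 := by rw [mul_add, ← hp', ← hq']; linarith
      exact Nat.lt_of_mul_lt_mul_left this
    have hPR : (X ^ (p + q) + C b * X ^ p + C (s * b) * X ^ q + C s : ℤ[X]) =
        (X ^ (p' + q') + C b * X ^ p' + C (s * b) * X ^ q' + C s : ℤ[X]).comp (X ^ g) := by
      rw [← quadrinomial_eq_comp_X_pow, hp', hq', mul_comm g p', mul_comm g q']
    intro hsub
    have hR := quadrinomial_monic_natDegree hp'0 hp'q' b s
    have hsubR : SubLehmer (X ^ (p' + q') + C b * X ^ p' + C (s * b) * X ^ q' + C s : ℤ[X]) := by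
      unfold SubLehmer at hsub ⊢
      rwa [hPR, intMahlerMeasure_comp_X_pow _ hg0] at hsub
    have h24 := twentyfour_le_natDegree_of_subLehmer hsubR
    rw [hR.2] at h24
    omega
  · -- the generic case: `deg(C_A C_B) ≤ 5g ≤ n/2`
    push Not at hsmall
    obtain ⟨ε, hε, hbε⟩ : ∃ ε : ℤ, (ε = 1 ∨ ε = -1) ∧ b = 2 * ε := by
      rcases hb with h | h
      · exact ⟨1, Or.inl rfl, by rw [h]; ring⟩
      · exact ⟨-1, Or.inr rfl, by rw [h]; ring⟩
    have hgen : p + q ≠ 2 * (q - p) := by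
      intro h
      have h4 : q = 3 * p := by omega
      have : g = p := by
        rw [hg, h4, show p + 3 * p = 4 * p by ring, Nat.gcd_mul_left_left]
      omega
    obtain ⟨CA, CB, Q, hPQ, hAW, hAV, hBn, hB3, hcfQ⟩ :=
      exists_cyclotomicFree_factor_quadrinomial_two hp hpq hs hε hbε hgen
    set P : ℤ[X] := X ^ (p + q) + C b * X ^ p + C (s * b) * X ^ q + C s with hP
    set n := p + q with hn
    have hP0 : P ≠ 0 := hmon.ne_zero
    have hCA0 : CA ≠ 0 := by rintro rfl; rw [zero_mul, zero_mul] at hPQ; exact hP0 hPQ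
    have hCB0 : CB ≠ 0 := by rintro rfl; rw [mul_zero, zero_mul] at hPQ; exact hP0 hPQ
    have hQ0 : Q ≠ 0 := by rintro rfl; rw [mul_zero] at hPQ; exact hP0 hPQ
    have hss : s * s = 1 := by rcases hs with h | h <;> simp [h]
    have hεε : ε * ε = 1 := by rcases hε with h | h <;> simp [h]
    -- degrees
    have hsign : ∀ {t : ℤ}, (t = 1 ∨ t = -1) → ∀ {N : ℕ}, 0 < N → (X ^ N - C t : ℤ[X]) ≠ 0 :=
      fun _ _ hN => X_pow_sub_C_ne_zero hN _
    obtain ⟨wA, hwA, hCAd⟩ := dvd_X_pow_gcd_sub_C (F := CA) _ (q - p) (2 * p) (-s) 1 le_rfl (by omega)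
      (by omega) (by rcases hs with h | h <;> simp [h]) (Or.inl rfl)
      (by rw [map_neg, sub_neg_eq_add]; exact hAW) (by rw [map_one]; exact hAV)
    obtain ⟨wB, hwB, hCBd⟩ := dvd_X_pow_gcd_sub_C (F := CB) _ (p + q) (3 * p) s (s * ε) le_rfl (by omega)
      (by omega) hs (by rcases hs with h | h <;> rcases hε with h' | h' <;> simp [h, h']) hBn hB3
    obtain ⟨hgA, hgB⟩ := gcd_bounds hp hpq
    have hdA : CA.natDegree ≤ 2 * g := by
      have := natDegree_le_of_dvd hCAd (hsign hwA (Nat.gcd_pos_of_pos_right _ (by omega)))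
      rw [natDegree_X_pow_sub_C] at this; omega
    have hdB : CB.natDegree ≤ 3 * g := by
      have := natDegree_le_of_dvd hCBd (hsign hwB (Nat.gcd_pos_of_pos_right _ (by omega)))
      rw [natDegree_X_pow_sub_C] at this; omega
    have hdegs : CA.natDegree + CB.natDegree + Q.natDegree = n := by
      rw [← hdeg, hPQ, natDegree_mul (mul_ne_zero hCA0 hCB0) hQ0, natDegree_mul hCA0 hCB0]
    have hQn : n ≤ 2 * Q.natDegree := by omega
    -- measures of the cyclotomic parts
    have hMA : intMahlerMeasure CA = 1 := by
      obtain ⟨V', hV'⟩ := hAV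
      exact intMahlerMeasure_eq_one_of_mul_eq_X_pow_sub_one (by omega : 0 < 2 * p) hV'.symm
    have hMB : intMahlerMeasure CB = 1 := by
      obtain ⟨V', hV'⟩ := hB3
      have hsε2 : (s * ε) * (s * ε) = 1 := by
        rcases hs with h | h <;> rcases hε with h' | h' <;> simp [h, h']
      have e : CB * (V' * (X ^ (3 * p) + C (s * ε))) = X ^ (6 * p) - 1 := by
        rw [← mul_assoc, ← hV']
        have hC : (C (s * ε) : ℤ[X]) * C (s * ε) = 1 := by rw [← map_mul, hsε2, map_one]
        linear_combination (-1 : ℤ[X]) * hC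
      exact intMahlerMeasure_eq_one_of_mul_eq_X_pow_sub_one (by omega : 0 < 6 * p) e
    have hMQ : intMahlerMeasure Q = intMahlerMeasure P := by
      rw [hPQ, intMahlerMeasure_mul, intMahlerMeasure_mul, hMA, hMB, one_mul, one_mul]
    -- even resultant step on `Q`
    set T : ℤ[X] := X ^ p + C s * X ^ q with hT
    have hCs : (C s : ℤ[X]) * C s = 1 := by rw [← map_mul, hss, map_one]
    have hG : (X ^ (2 * n) - 1 : ℤ[X]) =
        C (4 * ε) * (T * (C ε * T + C s)) + Q * (CA * CB * (P - C (4 * ε) * T - C (2 * s))) := by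
      have e : Q * (CA * CB * (P - C (4 * ε) * T - C (2 * s))) = P * (P - C (4 * ε) * T - C (2 * s)) := by
        rw [hPQ]; ring
      rw [e, hP, hT, hbε]
      simp only [map_mul, map_ofNat]
      linear_combination hCs
    have hGdeg : (X ^ (2 * n) - 1 : ℤ[X]).natDegree ≤ 2 * n := by rw [← C_1, natDegree_X_pow_sub_C]
    have hne : Q.resultant (X ^ (2 * n) - 1) Q.natDegree (2 * n) ≠ 0 :=
      resultant_X_pow_sub_one_ne_zero hQ0 hcfQ (by omega)
    have hTdeg : T.natDegree ≤ q := by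
      rw [hT]
      refine (natDegree_add_le _ _).trans (max_le ?_ ?_)
      · rw [natDegree_X_pow]; omega
      · exact (natDegree_C_mul_le _ _).trans (by rw [natDegree_X_pow])
    have hHdeg : (CA * CB * (P - C (4 * ε) * T - C (2 * s))).natDegree + Q.natDegree ≤ 2 * n := by
      have h1 : (P - C (4 * ε) * T - C (2 * s)).natDegree ≤ n := by
        refine (natDegree_sub_le _ _).trans (max_le ((natDegree_sub_le _ _).trans (max_le ?_ ?_)) ?_)
        · rw [hdeg]
        · exact (natDegree_C_mul_le _ _).trans (hTdeg.trans (by omega))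
        · rw [natDegree_C]; omega
      have h2 : (CA * CB * (P - C (4 * ε) * T - C (2 * s))).natDegree ≤
          (CA * CB).natDegree + (P - C (4 * ε) * T - C (2 * s)).natDegree := natDegree_mul_le
      rw [natDegree_mul hCA0 hCB0] at h2
      omega
    have hroot : ∀ α : ℂ, ‖((X ^ (2 * n) - 1 : ℤ[X]).map (Int.castRingHom ℂ)).eval α‖ ≤
        2 * max 1 ‖α‖ ^ (2 * n) := by
      intro α
      simp only [Polynomial.map_sub, Polynomial.map_pow, map_X, Polynomial.map_one, eval_sub, eval_pow,
        eval_X, eval_one]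
      have := norm_pow_add_le_two_mul α (-1) (by simp) (2 * n)
      rwa [← sub_eq_add_neg] at this
    have h := abs_pow_le_pow_mul_measure_pow_of_resultant (K := 2) hG hHdeg hGdeg hne hroot
    rw [hMQ] at h
    -- `|4ε| = 4`: `4^{deg Q} ≤ 2^{deg Q} M^{2n}` ⇒ `2^{deg Q} ≤ M^{2n}` ⇒ `2^n ≤ M^{4n}` ⇒ `2 ≤ M^4`
    set M := intMahlerMeasure P with hM
    have hM1 : 1 ≤ M := one_le_intMahlerMeasure hP0
    have h4 : (|((4 : ℤ) * ε : ℤ)| : ℝ) = 2 * 2 := by rcases hε with h' | h' <;> simp [h'] <;> norm_num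
    rw [h4, mul_pow] at h
    have h2 : (2 : ℝ) ^ Q.natDegree ≤ M ^ (2 * n) := by
      have hpos : (0 : ℝ) < 2 ^ Q.natDegree := by positivity
      nlinarith
    have h3 : (2 : ℝ) ^ n ≤ (M ^ 4) ^ n := by
      calc (2 : ℝ) ^ n ≤ 2 ^ (2 * Q.natDegree) := pow_le_pow_right₀ (by norm_num) hQn
        _ = (2 ^ Q.natDegree) ^ 2 := by rw [mul_comm, pow_mul]
        _ ≤ (M ^ (2 * n)) ^ 2 := pow_le_pow_left₀ (by positivity) h2 2
        _ = (M ^ 4) ^ n := by rw [← pow_mul, ← pow_mul]; ring_nf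
    have hM4 : (2 : ℝ) ≤ M ^ 4 := le_of_pow_le_pow_left₀ (by omega : n ≠ 0) (by positivity) h3
    intro hsub
    have hL := lehmer_measure_upper_bound
    obtain ⟨_, hlt⟩ := hsub
    have hMlt : M < 117629 / 100000 := lt_trans hlt hL
    have hM0 : 0 ≤ M := by linarith
    have : M ^ 4 < (117629 / 100000 : ℝ) ^ 4 := pow_lt_pow_left₀ hMlt hM0 (by norm_num)
    norm_num at this
    linarith

end Quadrinomial

end Summit.Ventures.DiscreteObjects.Mahler
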